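import Summits.KontsevichZagierPeriods.KontsevichZagierPeriods.Theorems.FurushoPentagonKernelModuloPeriodConjectureMzvSectorTransfer
import Summits.KontsevichZagierPeriods.KontsevichZagierPeriods.Theorems.FurushoPentagonKernelModuloPeriodConjectureLeafLowWeight
import Summits.KontsevichZagierPeriods.KontsevichZagierPeriods.Theorems.FurushoPentagonKernelModuloPeriodConjectureLeafWeightFive
import Summits.KontsevichZagierPeriods.KontsevichZagierPeriods.Theorems.FurushoPentagonKernelModuloPeriodConjectureLeafWeightSix
import Summits.KontsevichZagierPeriods.KontsevichZagierPeriods.Theorems.FurushoPentagonKernelModuloPeriodConjectureLeafWeightSeven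
import Summits.KontsevichZagierPeriods.KontsevichZagierPeriods.Theorems.FurushoPentagonKernelModuloPeriodConjectureLeafWeightEight
import Summits.KontsevichZagierPeriods.KontsevichZagierPeriods.Theorems.FurushoPentagonKernelModuloPeriodConjectureLeafWeightNine
import Summits.KontsevichZagierPeriods.KontsevichZagierPeriods.Theorems.FurushoPentagonKernelModuloPeriodConjectureLeafOfCheck
import Summits.KontsevichZagierPeriods.KontsevichZagierPeriods.Theorems.FurushoPentagonKernelModuloPeriodConjectureLeafOfCheckBlocks
import Summits.KontsevichZagierPeriods.KontsevichZagierPeriods.Theorems.FurushoPentagonKernelModuloPeriodConjectureEdsCheckWeightTen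
import Summits.KontsevichZagierPeriods.KontsevichZagierPeriods.Theorems.FurushoPentagonKernelModuloPeriodConjectureEdsCheckWeightEleven
import Summits.KontsevichZagierPeriods.KontsevichZagierPeriods.Theorems.FurushoPentagonKernelModuloPeriodConjectureEdsCheckWeightTwelve
import Summits.KontsevichZagierPeriods.KontsevichZagierPeriods.Theorems.FurushoPentagonKernelModuloPeriodConjectureEdsCheckWeightThirteen
import Summits.KontsevichZagierPeriods.KontsevichZagierPeriods.Theorems.FurushoPentagonKernelModuloPeriodConjectureEdsBlockWeightFourteenA
import Summits.KontsevichZagierPeriods.KontsevichZagierPeriods.Theorems.FurushoPentagonKernelModuloPeriodConjectureEdsBlockWeightFourteenB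
import Summits.KontsevichZagierPeriods.KontsevichZagierPeriods.Theorems.FurushoPentagonKernelModuloPeriodConjectureEdsBlockWeightFourteenC
import Summits.KontsevichZagierPeriods.KontsevichZagierPeriods.Theorems.FurushoPentagonKernelModuloPeriodConjectureEdsBlockWeightFourteenD
import Summits.KontsevichZagierPeriods.KontsevichZagierPeriods.Theorems.FurushoPentagonKernelModuloPeriodConjectureEdsBlockWeightFourteenE
import HarnessLib

/-!
# `KernelModuloPeriodConjecture`, line `Sketch`: Hoffman spanning for abstract associators, weight ≤ 14

Crux `FurushoPentagon.KernelModuloPeriodConjecture` (stmt-KontsevichZagierPeriods-15058), line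
`Sketch`. ONE citable theorem assembling the landed weight slices of the algebraic leaf
`AssociatorHoffmanSpanning` — Hoffman words span `𝒪(GroupLike ∩ Pent)_red` weight by weight, the
coordinate form of `GRT₁ ≅ U^{dR}_{MT(ℤ)}` — for EVERY admissible index of weight `≤ 14`: weight
`≤ 4` is the tree theorem `associatorHoffmanSpanning_of_weight_le_four`, weights 5–9 the certificate
files of leads c1/c2 (`stub_leafWeightFive…Nine`), weights 10–13 the kernel-checked GF(2) rank
engine `LinEDS.check` with its master soundness theorem `stub_leaf_of_check` (lead c5), weight 14
five depth-block kernel runs with the block master `stub_leaf_of_checkBlocks`. For comparison, the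
printed verifications of Ihara–Kaneko–Zagier's Conjecture 1 are numerical (IKZ) or by ranks modulo
a prime for real MZVs (Kaneko–Noro–Tsurumaki, to weight 20); here the statement is for every
group-like solution of Drinfeld's pentagon over every commutative `ℚ`-algebra and is checked by
Lean's kernel.

References: K. Ihara, M. Kaneko, D. Zagier, Compos. Math. 142 (2006) §2, Conjecture 1
[IharaKanekoZagier2006]; H. Furusho, Ann. of Math. 174 (2011) Thm 1.2 [Furusho2011]; F. Brown,
Ann. of Math. 175 (2012) Thm 1.1 [Brown2012]; V. Drinfeld, Leningrad Math. J. 2 (1991).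
-/

namespace Summit.KontsevichZagierPeriods.FurushoPentagon.KernelModuloPeriodConjecture

open Literature.NumberTheory.Transcendental

/-- **Registered stub `stub_associatorHoffmanSpanning_of_weight_le_14`** (lead c5; crux
stmt-KontsevichZagierPeriods-15058, line `Sketch`): the algebraic leaf for every admissible index of
weight at most `14` — for each such `s` one finitely supported `b` on Hoffman indices of the same
weight with `c_{bw s}(φ) = Σ_t b_t c_{bw t}(φ)` at every group-like solution `φ` of Drinfeld's
pentagon over every (reduced) commutative `ℚ`-algebra. [cite: IharaKanekoZagier2006, Conjecture 1] -/
theorem stub_associatorHoffmanSpanning_of_weight_le_14 :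
    ∀ s : List ℕ, MZV.IsAdmissible s → MZV.weight s ≤ 14 →
      ∃ b : List ℕ →₀ ℚ, (∀ t ∈ b.support, MZV.IsHoffman t ∧ MZV.weight t = MZV.weight s) ∧ ∀ (R : Type) [CommRing R] [Algebra ℚ R] [IsReduced R] (φ : NCSeries Bool R), NCSeries.IsGroupLike φ → NCSeries.DrinfeldPentagon φ → φ (MZV.binaryWord s) = b.sum (fun t q => q • φ (MZV.binaryWord t)) := by
  intro s hs h14
  by_cases h4 : MZV.weight s ≤ 4
  · exact associatorHoffmanSpanning_of_weight_le_four hs h4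
  by_cases h5 : MZV.weight s = 5
  · exact stub_leafWeightFive s hs h5
  by_cases h6 : MZV.weight s = 6
  · exact stub_leafWeightSix s hs h6
  by_cases h7 : MZV.weight s = 7
  · exact stub_leafWeightSeven s hs h7
  by_cases h8 : MZV.weight s = 8
  · exact stub_leafWeightEight s hs h8
  by_cases h9 : MZV.weight s = 9
  · exact stub_leafWeightNine s hs h9
  by_cases h10 : MZV.weight s = 10
  · obtain ⟨names, h⟩ := stub_edsCheck_weight_10
    exact stub_leaf_of_check 10 names h s hs h10
  by_cases h11 : MZV.weight s = 11
  · obtain ⟨names, h⟩ := stub_edsCheck_weight_11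
    exact stub_leaf_of_check 11 names h s hs h11
  by_cases h12 : MZV.weight s = 12
  · obtain ⟨names, h⟩ := stub_edsCheck_weight_12
    exact stub_leaf_of_check 12 names h s hs h12
  by_cases h13 : MZV.weight s = 13
  · obtain ⟨names, h⟩ := stub_edsCheck_weight_13
    exact stub_leaf_of_check 13 names h s hs h13
  have hw : MZV.weight s = 14 := by omega
  refine stub_leaf_of_checkBlocks 14 [(0, 6), (6, 7), (7, 8), (8, 9), (9, 13)] (by norm_num)
    (List.cons_ne_nil _ _) (by decide) rfl (by decide) (fun p hp => ?_)
    (show LinEDS.depthCovered 14 13 = true from stub_depthCovered_14) s hs hw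
  simp only [List.mem_cons, List.not_mem_nil, or_false] at hp
  rcases hp with rfl | rfl | rfl | rfl | rfl
  · exact stub_edsBlock_14_0_6
  · exact stub_edsBlock_14_6_7
  · exact stub_edsBlock_14_7_8
  · exact stub_edsBlock_14_8_9
  · exact stub_edsBlock_14_9_13

end Summit.KontsevichZagierPeriods.FurushoPentagon.KernelModuloPeriodConjecture
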